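import Summits.Schanuel.Schanuel.Theorems.SoloInformedPiELadder
import Literature.NumberTheory.Transcendental.PhilipponCriterionHolds
import Literature.NumberTheory.Transcendental.PhilipponMainCriterionHolds
import Literature.AlgebraicGeometry.Resolution.AlterationsEnlargingZ -- for `range_fin_append`

/-!
# Door (P): the criterion currency — Philippon data at `(e, π)` and along `(z, e^z)`
# (soloist Proposition PD)

Soloist file (`solo-Schanuel-informed`, residency session s69, 2026-08-22), companion of
`SoloInformedNesterenkoDoor` (door (N), the linear-form currency).  The soloist's statement of
"what a proof of `e ⟂ π` must do" names one missing theorem in several currencies (atlas §3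
S2/S2′/S2″; SHARPEST §2 M3/M4): Roy's small value estimate (S2; typed in the tree,
`Literature.NumberTheory.Transcendental.Roy2001_iff_holds` and the soloist's `Roy*` files), the
criterion / elimination currency (S2′) and the simultaneous-approximation currency (S2″).  This
file TYPES the criterion currency, using the library's KERNEL PROOFS of Philippon's criterion for
algebraic independence — the rigid form of Nesterenko–Philippon (eds.), LNM 1752, Ch. 14,
Prop. 3.2 (`Philippon1986_criterion_holds`) and Philippon's main criterion, IHÉS 64 (1986),
Thm 2.11 for `K = ℚ`, `v = ∞` (`Philippon1986_mainCriterion_holds`).  Nothing here is deep: every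
statement is the criterion read at a Schanuel point.  The point is that the door is now a decl with
a number attached (§3), exactly as door (N) was.

## Statements

* §1 (data).  `philipponData θ a C` is the set of sequences of finite families
  `Q_{N,1}, …, Q_{N,m(N)} ∈ ℤ[X₁, …, X_q]` (`m(N) ≥ 1`) which, for all large `N`, have total
  degree `≤ N`, height `≤ e^N`, values `|Q_{N,j}(θ)| ≤ e^{-CN^a}` and NO common zero in the
  polydisc `max_i |z_i − θ_i| ≤ e^{-3CN^a}` — the hypothesis of LNM 1752 Ch. 14 Prop. 3.2 verbatim.
  `philipponMainData θ k C σ δ R S` is the flexible version (Philippon's Thm 2.11 with growth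
  functions `σ, δ, R, S`, finitely many common zeros in the ball `e^{-R}`, `log L ≤ σ`, `deg ≤ δ`,
  `0 < max_j |Q_{N,j}(θ)| ≤ e^{-S}`, growth `S^{k+2} ≥ C (σ+δ) δ^k (S^{k+1} + R^{k+1})`).
* §2 (doors).  Rigid: data of exponent `a ≥ 1` for every constant `C > 0` give
  `trdeg_ℚ ℚ(θ) ≥ ⌊a⌋` (`floor_le_trdeg_of_philipponData`); at `θ = (e, π)`, `a = 2`:
  **`e ⟂ π`** (`expOnePiAlgebraicIndependent_of_philipponData`; in Roy's coordinates
  `θ = (1, πi, e, −1)`: `expOnePiAlgebraicIndependent_of_philipponData_graph`); at `θ = (y, e^y)`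
  for a `ℚ`-linearly independent `y ∈ ℂˡ`, `a = l`: Schanuel's inequality at `y`, whence
  `SchanuelRank l` and `Schanuel` itself from data at every Schanuel point
  (`schanuelRank_of_philipponData`, `schanuel_of_philipponData`) — the (S2′) door literally ends
  at the summit, as Roy's does.  Flexible: main-criterion data with `k` give `trdeg ≥ k + 1`
  (`succ_le_trdeg_of_philipponMainData`); `k = 1` at `(e, π)` gives `e ⟂ π`
  (`expOnePiAlgebraicIndependent_of_philipponMainData`).
  The constant is quantified `∀ C` because it is existential in the criterion and the zero-free
  clause is not monotone in `C` (a smaller ball is a weaker requirement).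
* §3 (the number: Roy's window against the criterion's threshold).  With `k = 1` and `R ≤ S` the
  growth condition of the main criterion amounts to `S ≥ c·C (σ + δ) δ` with `1 ≤ c ≤ 2`:
  smallness must beat HEIGHT × DEGREE.  For the one family a Roy witness `P_N` supplies at
  `(1, πi)` — the real and imaginary parts of `D^k P_N(m₁ + m₂ i X, (−1)^{m₂} Y^{m₁})`,
  `k ≤ N^{s₀}`, `m ≤ N^{s₁}`, read at `(π, e)` — the exponents are `δ ≍ N^{max(t₀, s₁+t₁)}`,
  `σ = N^{s₀ + o(1)}`, `S = N^u` (atlas §3 S2′; this bookkeeping is PROSE, not constructed here),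
  so the criterion would need `u ≥ s₀ + s₁ + t₁` up to `o(1)`.  `roy_window_philippon_deficit`
  certifies that on the whole of Roy's window (1) (`RoyAdmissible`) one has
  `u + (1 + t₁)/2 < s₀ + s₁ + t₁`: the deficit exceeds `N^{1/2}` at every admissible parameter —
  the soloist's "(S2′) fails by a power ≥ N^{1/2}; the criterion threshold IS the counting scale",
  now against the tree's own `RoyAdmissible`.

## Reading (atlas §3 S2′, SHARPEST §2 M4)

Smallness alone is free: at every point `θ ∈ ℂ^q` Dirichlet's box principle supplies, for all
large `N`, a non-zero integer polynomial of degree `≤ N` and height `≤ e^N` with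
`|Q(θ)| ≤ e^{-cN^{q+1}}` (`c = c(q, θ) > 0`), which beats `e^{-CN^a}` for every `a < q + 1` and
every `C`.  So the criterion's force lies entirely in "no common zero near `θ`" for a FAMILY — the
elimination-theoretic form of "read the joint arithmetic of two numbers below the counting scale".
For the one family Roy's Conjecture 2 would supply at `(1, πi)` the zero-free clause is not the
obstacle (exact common zeros off the degenerate locus are excluded by Philippon's zero estimate,
atlas §3 (S2′) and A53; the box-value version is the soloist's `SoloInformedRoyNoExactZeros`; the
family version is not re-proved here), and the smallness is short by `N^{(1+t₁)/2}` (§3).  No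
family meeting §2 at `(e, π)` is known; the one conjectural supply line in print, Roy's
Conjecture 2, lands below the threshold; the door is typed so that this distance is a number.

## References

* [Philippon1986] P. Philippon, *Critères pour l'indépendance algébrique*, Publ. Math. IHÉS 64
  (1986) 5–52, Thm 2.11 — used through
  `Literature/NumberTheory/Transcendental/PhilipponCriterion.lean` (statements) and
  `PhilipponMainCriterionHolds.lean` (kernel proof, `K = ℚ`, `v = ∞`).
* [NesterenkoPhilippon2001] Yu. V. Nesterenko, P. Philippon (eds.), *Introduction to Algebraic
  Independence Theory*, LNM 1752 (2001), Ch. 14 Prop. 3.2, p. 251 — through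
  `PhilipponCriterionHolds.lean` (kernel proof).
* [Roy2001] D. Roy, *An arithmetic criterion for the values of the exponential function*, Acta
  Arith. 97 (2001) 183–194, window (1) — through `RoyCriterion.lean` (`RoyAdmissible`).
-/

noncomputable section

open Filter Topology MvPolynomial Complex IntermediateField
open Literature.NumberTheory.Transcendental (ExpOnePiAlgebraicIndependent SchanuelRank mvPolyHeight
  RoyAdmissible Philippon1986_criterion_holds Philippon1986_mainCriterion_holds)

namespace Summit.Schanuel.Schanuel.Theorems

/-! ### §1 Philippon data -/

/-- **Philippon data** (rigid form, LNM 1752 Ch. 14 Prop. 3.2) of exponent `a` and constant `C`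
at `θ ∈ ℂ^q`: sequences `N ↦ (Q_{N,j})_{j < m(N)}` of integer polynomials such that for all large
`N`: `m(N) ≥ 1`, `deg Q_{N,j} ≤ N`, `H(Q_{N,j}) ≤ e^N`, `|Q_{N,j}(θ)| ≤ e^{-CN^a}`, and the
`Q_{N,j}` have no common zero in the polydisc `max_i |z_i − θ_i| ≤ e^{-3CN^a}`. -/
def philipponData {q : ℕ} (θ : Fin q → ℂ) (a C : ℝ) :
    Set (Σ m : ℕ → ℕ, ((N : ℕ) → Fin (m N) → MvPolynomial (Fin q) ℤ)) :=
  {D | ∀ᶠ N : ℕ in atTop, 1 ≤ D.1 N ∧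
      (∀ j, (D.2 N j).totalDegree ≤ N) ∧
      (∀ j, (mvPolyHeight (D.2 N j) : ℝ) ≤ Real.exp N) ∧
      (∀ j, ‖aeval θ (D.2 N j)‖ ≤ Real.exp (-(C * (N : ℝ) ^ a))) ∧
      ∀ z : Fin q → ℂ, (∀ i, ‖z i - θ i‖ ≤ Real.exp (-(3 * C * (N : ℝ) ^ a))) →
        ∃ j, aeval z (D.2 N j) ≠ 0}

/-- **Philippon main-criterion data** (Philippon 1986 Thm 2.11, `K = ℚ`, `v = ∞`, the tree's
`Philippon1986_mainCriterion`) at `θ ∈ ℂⁿ` for the level `k`, the constant `C` and growth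
functions `σ, δ, R, S`: the growth conditions of the criterion together with a sequence of finite
families of integer polynomials of degree `≤ δ(N)`, `log L ≤ σ(N)`, finitely many common zeros in
the ball `e^{-R(N)}` about `θ`, not all vanishing at `θ`, and `|Q_{N,j}(θ)| ≤ e^{-S(N)}`, from some
`N₀` on. -/
def philipponMainData {n : ℕ} (θ : Fin n → ℂ) (k : ℕ) (C : ℝ) (σ δ R S : ℕ → ℝ) :
    Set (Σ m : ℕ → ℕ, ((N : ℕ) → Fin (m N) → MvPolynomial (Fin n) ℤ)) :=
  {D | Monotone σ ∧ Monotone δ ∧ Monotone R ∧ Monotone S ∧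
      (∀ N, 1 ≤ σ N) ∧ (∀ N, 1 ≤ δ N) ∧ (∀ N, 1 ≤ R N) ∧ (∀ N, 1 ≤ S N) ∧
      Tendsto (fun N => σ N + δ N) atTop atTop ∧
      Monotone (fun N => S N / ((σ N + δ N) * δ N ^ k)) ∧
      (∀ N, C * (σ (N + 1) + δ (N + 1)) * δ (N + 1) ^ k * (S N ^ (k + 1) + R (N + 1) ^ (k + 1))
          ≤ S N ^ (k + 2)) ∧
      ∃ N₀ : ℕ, ∀ N, N₀ ≤ N →
        Set.Finite {z : Fin n → ℂ | (∀ i, ‖z i - θ i‖ ≤ Real.exp (-R N)) ∧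
            ∀ j, aeval z (D.2 N j) = 0} ∧
        (∀ j, ((D.2 N j).totalDegree : ℝ) ≤ δ N) ∧
        (∀ j, Real.log (Literature.NumberTheory.Transcendental.Chudnovsky.l1 (D.2 N j)) ≤ σ N) ∧
        (∃ j, aeval θ (D.2 N j) ≠ 0) ∧
        (∀ j, ‖aeval θ (D.2 N j)‖ ≤ Real.exp (-S N))}

/-! ### §2 The doors -/

/-- **Door (P), rigid form.** Philippon data of exponent `a ≥ 1` at `θ`, for every constant
`C > 0`, give `trdeg_ℚ ℚ(θ) ≥ ⌊a⌋` — the kernel-proved LNM 1752 Ch. 14 Prop. 3.2 read as a door. -/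
theorem floor_le_trdeg_of_philipponData {q : ℕ} (θ : Fin q → ℂ) {a : ℝ} (ha : 1 ≤ a)
    (h : ∀ C : ℝ, 0 < C → (philipponData θ a C).Nonempty) :
    ((⌊a⌋₊ : ℕ) : Cardinal) ≤ Algebra.trdeg ℚ ↥(adjoin ℚ (Set.range θ)) := by
  obtain ⟨C, hC, himp⟩ := Philippon1986_criterion_holds q θ a ha
  obtain ⟨D, hD⟩ := h C hC
  exact himp (hD.mono fun N hN => ⟨D.1 N, D.2 N, hN⟩)

/-- Door (P) with an integer exponent `a = n ≥ 1`: `trdeg_ℚ ℚ(θ) ≥ n`. -/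
theorem natCast_le_trdeg_of_philipponData {q : ℕ} (θ : Fin q → ℂ) {n : ℕ} (hn : 1 ≤ n)
    (h : ∀ C : ℝ, 0 < C → (philipponData θ n C).Nonempty) :
    (n : Cardinal) ≤ Algebra.trdeg ℚ ↥(adjoin ℚ (Set.range θ)) := by
  have h' := floor_le_trdeg_of_philipponData θ (a := n) (by exact_mod_cast hn) h
  simpa only [Nat.floor_natCast] using h'

/-- The range of the pair `(e, π)` as a subset of `ℂ`. -/
theorem range_expOne_pi :
    Set.range ![((Real.exp 1 : ℝ) : ℂ), ((Real.pi : ℝ) : ℂ)] =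
      ({((Real.exp 1 : ℝ) : ℂ), ((Real.pi : ℝ) : ℂ)} : Set ℂ) := by
  ext w
  simp only [Set.mem_range, Set.mem_insert_iff, Set.mem_singleton_iff]
  constructor
  · rintro ⟨i, rfl⟩; fin_cases i <;> simp
  · rintro (rfl | rfl); exacts [⟨0, by simp⟩, ⟨1, by simp⟩]

/-- **Door (P) at the emblematic point: Philippon data of exponent `2` at `(e, π)` give `e ⟂ π`.**
If for every `C > 0` and all large `N` there are integer polynomials `Q_{N,j}(X, Y)` of degree
`≤ N` and height `≤ e^N` with `|Q_{N,j}(e, π)| ≤ e^{-CN²}` and no common zero within `e^{-3CN²}`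
of `(e, π)`, then `e` and `π` are algebraically independent. -/
theorem expOnePiAlgebraicIndependent_of_philipponData
    (h : ∀ C : ℝ, 0 < C →
      (philipponData ![((Real.exp 1 : ℝ) : ℂ), ((Real.pi : ℝ) : ℂ)] 2 C).Nonempty) :
    ExpOnePiAlgebraicIndependent := by
  have h2 := natCast_le_trdeg_of_philipponData ![((Real.exp 1 : ℝ) : ℂ), ((Real.pi : ℝ) : ℂ)]
    (n := 2) (by norm_num) (by exact_mod_cast h)
  rw [range_expOne_pi] at h2
  exact (two_le_trdeg_adjoin_pair_iff (Real.exp 1) Real.pi).mp (by exact_mod_cast h2)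

/-- **Door (P) at a Schanuel point.** For `y ∈ ℂˡ` linearly independent over `ℚ`, Philippon data
of exponent `l` at the `2l`-tuple `(y, e^y)`, for every `C > 0`, give Schanuel's inequality
`trdeg_ℚ ℚ(y, e^y) ≥ l` at `y`. -/
theorem le_trdeg_expField_of_philipponData {l : ℕ} (y : Fin l → ℂ)
    (h : ∀ C : ℝ, 0 < C → (philipponData (Fin.append y (cexp ∘ y)) l C).Nonempty) :
    (l : Cardinal) ≤ Algebra.trdeg ℚ ↥(adjoin ℚ (Set.range y ∪ Set.range (cexp ∘ y))) := by
  rcases Nat.eq_zero_or_pos l with rfl | hl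
  · simp
  have h' := natCast_le_trdeg_of_philipponData (Fin.append y (cexp ∘ y)) hl h
  rwa [Literature.AlgebraicGeometry.Resolution.range_fin_append] at h'

/-- **Door (P) in Roy's coordinates.** Philippon data of exponent `2` at the `4`-tuple
`(y, e^y) = (1, πi, e, −1)`, `y = (1, πi)`, for every `C > 0`, give `e ⟂ π` (through the soloist's
`two_le_trdeg_expField_one_piI_iff`: `trdeg ℚ(1, πi, e, −1) = trdeg ℚ(e, π)`). -/
theorem expOnePiAlgebraicIndependent_of_philipponData_graph
    (h : ∀ C : ℝ, 0 < C →
      (philipponData (Fin.append ![(1 : ℂ), (Real.pi : ℂ) * I]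
        (cexp ∘ ![(1 : ℂ), (Real.pi : ℂ) * I])) 2 C).Nonempty) :
    ExpOnePiAlgebraicIndependent :=
  two_le_trdeg_expField_one_piI_iff.mp (le_trdeg_expField_of_philipponData _ h)

/-- **Door (P) at rank `l`: Philippon data of exponent `l` at every Schanuel point of rank `l` give
`SchanuelRank l`.** -/
theorem schanuelRank_of_philipponData {l : ℕ}
    (h : ∀ y : Fin l → ℂ, LinearIndependent ℚ y →
      ∀ C : ℝ, 0 < C → (philipponData (Fin.append y (cexp ∘ y)) l C).Nonempty) :
    SchanuelRank l :=
  fun y hy => le_trdeg_expField_of_philipponData y (h y hy)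

/-- **The (S2′) door ends at the summit.** Philippon data of exponent `l` at `(y, e^y)` for every
`ℚ`-linearly independent `y ∈ ℂˡ`, every `l` and every constant give Schanuel's conjecture. -/
theorem schanuel_of_philipponData
    (h : ∀ (l : ℕ) (y : Fin l → ℂ), LinearIndependent ℚ y →
      ∀ C : ℝ, 0 < C → (philipponData (Fin.append y (cexp ∘ y)) l C).Nonempty) :
    _root_.Schanuel := by
  intro l y hy
  exact le_trdeg_expField_of_philipponData y (h l y hy)

/-- **Door (P), flexible form.** Main-criterion data at level `k ≤ n` at `θ ∈ ℂⁿ`, for every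
constant `C ≥ 1` (with growth functions depending on `C`), give `trdeg_ℚ ℚ(θ) ≥ k + 1` — the
kernel-proved Philippon Thm 2.11 read as a door. -/
theorem succ_le_trdeg_of_philipponMainData {n k : ℕ} (θ : Fin n → ℂ) (hk : k ≤ n)
    (h : ∀ C : ℝ, 1 ≤ C → ∃ σ δ R S : ℕ → ℝ, (philipponMainData θ k C σ δ R S).Nonempty) :
    ((k + 1 : ℕ) : Cardinal) ≤ Algebra.trdeg ℚ ↥(adjoin ℚ (Set.range θ)) := by
  obtain ⟨C, hC, himp⟩ := Philippon1986_mainCriterion_holds n k θ hk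
  obtain ⟨σ, δ, R, S, D, hσ, hδ, hR, hS, hσ1, hδ1, hR1, hS1, hlim, hmono, hgrowth, N₀, hN⟩ :=
    h C hC
  exact himp σ δ R S hσ hδ hR hS hσ1 hδ1 hR1 hS1 hlim hmono hgrowth N₀ D.1 D.2 hN

/-- **Door (P), flexible form, at `(e, π)`**: main-criterion data at level `k = 1` (growth
`S³ ≥ C (σ + δ) δ (S² + R²)`, i.e. smallness beating height × degree) give `e ⟂ π`. -/
theorem expOnePiAlgebraicIndependent_of_philipponMainData
    (h : ∀ C : ℝ, 1 ≤ C → ∃ σ δ R S : ℕ → ℝ,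
      (philipponMainData ![((Real.exp 1 : ℝ) : ℂ), ((Real.pi : ℝ) : ℂ)] 1 C σ δ R S).Nonempty) :
    ExpOnePiAlgebraicIndependent := by
  have h2 := succ_le_trdeg_of_philipponMainData ![((Real.exp 1 : ℝ) : ℂ), ((Real.pi : ℝ) : ℂ)]
    (k := 1) (by norm_num) h
  rw [range_expOne_pi] at h2
  exact (two_le_trdeg_adjoin_pair_iff (Real.exp 1) Real.pi).mp (by exact_mod_cast h2)

/-! ### §3 The number: Roy's window against the criterion's threshold -/

/-- **The (S2′) deficit on Roy's window.** For every admissible parameter set of Roy's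
Conjecture 2 (window (1), `RoyAdmissible`): `u + (1 + t₁)/2 < s₀ + s₁ + t₁`.  Reading (atlas §3
S2′): the family a Roy witness supplies at `(1, πi)` has height exponent `s₀ + o(1)` and degree
exponent `≥ s₁ + t₁`, and the main criterion at `k = 1` asks for smallness beyond height × degree,
i.e. `u ≥ s₀ + s₁ + t₁ − o(1)`; the available `u` misses this by more than `(1 + t₁)/2 > 1/2`
uniformly on the window. -/
theorem roy_window_philippon_deficit {s₀ s₁ t₀ t₁ u : ℝ} (h : RoyAdmissible s₀ s₁ t₀ t₁ u) :
    u + (1 + t₁) / 2 < s₀ + s₁ + t₁ := by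
  obtain ⟨hs₀, hs₁, ht₀, ht₁, hu, h1, h2, h3⟩ := h
  have h1a : (1 : ℝ) < min s₀ (2 * s₁) := lt_of_le_of_lt (le_max_left _ _) h1
  have h1b : max t₀ (2 * t₁) < min s₀ (2 * s₁) := lt_of_le_of_lt (le_max_right _ _) h1
  have hs₀1 : 1 < s₀ := lt_of_lt_of_le h1a (min_le_left _ _)
  have hs₁1 : 1 < 2 * s₁ := lt_of_lt_of_le h1a (min_le_right _ _)
  have ht₀s₀ : t₀ < s₀ := lt_of_le_of_lt (le_max_left _ _) (lt_of_lt_of_le h1b (min_le_left _ _))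
  linarith

/-- The same deficit against the degree exponent `max(t₀, s₁ + t₁)` and the height exponent
`max(s₀, t₀)` (`= s₀` on the window, where `t₀ < s₀`) of the Roy family: the threshold exponent
height + degree exceeds `u + 1/2` on the whole window. -/
theorem roy_window_below_philippon_threshold {s₀ s₁ t₀ t₁ u : ℝ}
    (h : RoyAdmissible s₀ s₁ t₀ t₁ u) :
    u + 1 / 2 < max s₀ t₀ + max t₀ (s₁ + t₁) := by
  have hd := roy_window_philippon_deficit h
  obtain ⟨hs₀, hs₁, ht₀, ht₁, -⟩ := h
  have ha : s₀ ≤ max s₀ t₀ := le_max_left _ _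
  have hb : s₁ + t₁ ≤ max t₀ (s₁ + t₁) := le_max_right _ _
  linarith

end Summit.Schanuel.Schanuel.Theorems

end
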